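import Literature.MathematicalPhysics.QuantumFieldTheory.Balaban1983to89.B12Lemma4CondIV
import Literature.MathematicalPhysics.QuantumFieldTheory.Balaban1983to89.B12Lemma4Models

/-!
# `Balaban1983to89.B12Lemma4CondIVModels` — T. Bałaban, *Renormalization group approach to lattice gauge field theories. I*,
Commun. Math. Phys. **109** (1987) 249–301 [Balaban1987RG1]: Lemma 4 (3.53) p. 280 for the printed pair `(𝐔, J(𝐔))` with condition (iv)
DERIVED from the identity (3.38) (`B12Lemma4CondIV.ofBackground_mem_space'_lemma4_of_eq338`) **in the two models of the tree** — the
`U(N)`-type model `B12RegularSpaces111Unitary.unitaryModel` (p. 251 «G … ⊂ U(N)»; `π` = the identity of `M_N(ℂ)`) and the `SU(N)` model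
`B12RegularSpaces111SpecialUnitary.suModel` (p. 252 «G is semisimple»; `π` = the traceless projection `B12Lemma4Models.slProj`) — the
model hypotheses `heGc` (`exp iξ𝔤ᶜ ⊂ Gᶜ`), `hπ` (`π` has values in `𝔤ᶜ`), `hgc` (`𝔤ᶜ` is `Ad(Gᶜ)`-stable) and `hπR` (`π` commutes with `Ad` of
every unit, the hypothesis under which the current (1.8) is gauge covariant) DISCHARGED, as `B12Lemma4Models` does for
`B12Lemma4Space.ofBackground_mem_space'_lemma4`.

HONEST FRAMING (cell `lit-balaban`, verbatim): statement-level skeleton of published theorems with citation tags; proofs where landed; nothing here is a claim about the Yang–Mills mass gap.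

PDF held: `paper:balaban1987-cmp109-rg-i-small-field` (journal page = PDF page + 248); pp. 251–252, 261, 278, 280 as read for
`B12Lemma4Models`, `B12Eq338CondIV`, `B12Lemma4CondIV`.

THE PRINT, verbatim (p. 261, (1.8)): *«J_j = D^{ξ*}_{U_j} ξ⁻² π Im ∂U_j, where π denotes the projection in the space of all complex N × N
matrices onto the algebra 𝔤ᶜ»*; p. 278: *«the condition (iv) is a consequence of the condition (iii), with a bit better constant, for the
pair of configurations exp iξ𝐇_j(…), D^{ξ*}_{exp iξ𝐇_j(…)}ξ⁻²π Im ∂ exp iξ𝐇_j(…)»*; p. 280, Lemma 4 (3.53) as quoted in `B12Lemma4CondIV`.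

WHAT IS PROVED.  §1–§2 `ofBackground_mem_space'_lemma4_of_eq338_unitary` (`𝓜 = unitaryModel 𝔸`, `π = id`: `heGc`, `hπ`, `hgc` vacuous —
`B12Lemma4Models.unitaryModel_heGc/_hπ/_hgc_Gc` —, `hπR` by `rfl`, `𝐊`, `𝐀₂` automatically `𝔤ᶜ`-valued) and
`ofBackground_mem_space'_lemma4_of_eq338_su` (`𝓜 = suModel N`, `π = slProj N`: `B12Lemma4Models.suModel_heGc`,
`slProj_mem_suModel_gc`, `suModel_hgc_Gc`, `slProj_conj`; `𝐊`, `𝐀₂` traceless); §3 the gauge clause for the printed pair in both models,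
`ofBackground_gaugeU_mem_space_iff_unitary/_su` (`(𝐔^u, J(𝐔^u)) ∈ U^c_j ↔ (𝐔, J(𝐔)) ∈ U^c_j`).  Everything else — the Lemma-4 inputs (3.41)/(3.37)/(3.45)/
(3.50), the J-budget on `Y`, the (3.38)-data, `ξ = L⁻ʲ`, `X̃⁻² ⊆ X`, «all the restrictions» + the unlisted `B₃ ≥ 1`, `B₃²O(1)M ≥ 1`,
`16·O(1)Mα₁ ≤ β`, `B₃″α₃ ≤ βL⁻²α₀` and the located `1 + 10β ≤ L²` (GAPS G-B12-03) — stays hypothesis, verbatim from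
`B12Lemma4CondIV.ofBackground_mem_space'_lemma4_of_eq338`.  No `def`, no `Prop` placeholder, no new fact; axioms standard.
Unit `lit-balaban-p07` (Phase-2 seat p07 gen 6; rows B12.Lem4 / B12.Eq1.8, owners r09/r20), HOME `run/shared/lean/pub/lit-balaban/`.
-/

namespace Literature.MathematicalPhysics.QuantumFieldTheory.Balaban1983to89.B12Lemma4CondIVModels

open Literature.MathematicalPhysics.QuantumFieldTheory.Balaban1983to89
open Literature.MathematicalPhysics.QuantumFieldTheory.Balaban1983to89.B12RegularSpaces111
open Literature.MathematicalPhysics.QuantumFieldTheory.Balaban1983to89.B12RegularSpaces111Unitary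
open Literature.MathematicalPhysics.QuantumFieldTheory.Balaban1983to89.B12RegularSpaces111SpecialUnitary
open Literature.MathematicalPhysics.QuantumFieldTheory.Balaban1983to89.B12Eq18Current
open Literature.MathematicalPhysics.QuantumFieldTheory.Balaban1983to89.B12Lemma4Models
open Literature.MathematicalPhysics.QuantumFieldTheory.Balaban1983to89.B12Lemma4CondIV

noncomputable section

variable {P : Params} {i : ℕ}

/-! ## §1. The `U(N)`-type model, `π = id` -/

/-- **Lemma 4 for the printed pair `(𝐔, J(𝐔))` with (iv) derived from (3.38), `U(N)`-type model** (`G = U(𝔸)`, `Gᶜ = 𝔸ˣ`, `𝔤ᶜ = 𝔸`,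
`π` the identity): `B12Lemma4CondIV.ofBackground_mem_space'_lemma4_of_eq338` with `heGc`, `hπ`, `hgc`, `hπR` and the `𝔤ᶜ`-valuedness of
`𝐊`, `𝐀₂` discharged. [cite: Balaban1987RG1, Lemma 4 (3.53) p.280 with (3.38) p.278 and (1.8) p.261] -/
theorem ofBackground_mem_space'_lemma4_of_eq338_unitary {𝔸 : Type*} [NormedRing 𝔸] [NormedAlgebra ℂ 𝔸] [CompleteSpace 𝔸]
    [StarRing 𝔸] (c : B12Sec2to5.Lemma4Consts) (hR : B12Sec2to5.Lemma4Restrictions c)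
    (hB : 1 ≤ c.B₃) (hY : 1 ≤ c.B₃ ^ 2 * c.O₁ * c.M) (hα₁ : 16 * (c.O₁ * c.M * c.α₁) ≤ c.β) (hL10 : 1 + 10 * c.β ≤ c.L ^ 2)
    {F : Frame P i 𝔸} {cs : StepConsts} (hξ : 0 < cs.ξ) (hξ1 : cs.ξ ≤ 1) (hcB : 0 < cs.cB)
    (hL : 1 ≤ cs.L) (hLξ : cs.L ^ cs.j * cs.ξ = 1)
    {η τ n B₃'' : ℝ} {j : ℕ} (hη : 0 ≤ η) (hj : 1 ≤ j) (hscale : c.L ^ j * η ≤ 1)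
    (hξx : cs.ξ * (c.L ^ (j - 1) * η) = c.L⁻¹ * η) (hτ0 : 0 ≤ τ) (hτ1 : τ ≤ 1) (hn : n < c.α₃)
    (hres'' : B₃'' * c.α₃ ≤ c.β * c.L⁻¹ ^ 2 * c.α₀)
    {Y : Region P i} (hXb : F.X.bonds ⊆ Y.bonds) (hXd : F.X.dpairs ⊆ Y.dpairs) (hX₂b : F.X₂.bonds ⊆ Y.bonds)
    (hX₂p : F.X₂.plaqs ⊆ F.X.plaqs)
    (hXp : ∀ p ∈ F.X.plaqs, (⟨p.src, p.μ⟩ : PBond P i) ∈ Y.bonds ∧ (⟨p.src.shift p.μ, p.ν⟩ : PBond P i) ∈ Y.bonds ∧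
      (⟨p.src.shift p.ν, p.μ⟩ : PBond P i) ∈ Y.bonds ∧ (⟨p.src, p.ν⟩ : PBond P i) ∈ Y.bonds ∧
      (p.src, p.μ, p.ν) ∈ Y.dpairs ∧ (p.src, p.ν, p.μ) ∈ Y.dpairs)
    {H K A : PBond P i → 𝔸} {ℓ : Plaq P i → 𝔸}
    (h41 : ∀ p ∈ F.X.plaqs, ‖((plaq (fun b => expI cs.ξ (H b)) p : 𝔸ˣ) : 𝔸) - 1‖ <
      Real.exp (c.B₃ ^ 2 * c.O₁ * c.M * c.α₀) * Real.exp (c.B₃ * c.O₁ * c.M * c.α₀) *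
      Real.exp (c.B₃ * c.O₁ * c.M * c.α₀) * Real.exp (c.O₁ * c.M * c.α₁) *
      ((1 + 2 * c.β) * c.α₀ * (c.L⁻¹ * η) ^ 2))
    (hH : ∀ b ∈ Y.bonds, ‖H b‖ < c.B₃ ^ 2 * c.O₁ * c.M * c.α₀ * (c.L ^ (j - 1) * η))
    (h45 : ∀ p ∈ F.X.plaqs, ‖(cs.ξ : ℂ)⁻¹ • (H ⟨p.src, p.μ⟩ + H ⟨p.src.shift p.μ, p.ν⟩ - H ⟨p.src.shift p.ν, p.μ⟩ -
      H ⟨p.src, p.ν⟩) - ℓ p‖ < c.B₃ * (c.B₃ * c.O₁ * c.M * c.α₀ * (c.L ^ (j - 1) * η)) ^ 2)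
    (hK : ∀ b ∈ Y.bonds, ‖K b‖ < c.B₃ ^ 2 * c.O₁ * c.M * c.α₀ * (c.L ^ (j - 1) * η))
    (hK1 : ∀ q ∈ Y.dpairs, ‖grad cs.ξ q.2.1 (fun y => K ⟨y, q.2.2⟩) q.1‖ < c.B₃ ^ 2 * c.O₁ * c.M * c.α₀ * (c.L ^ (j - 1) * η))
    (h45τ : ∀ p ∈ F.X.plaqs, ‖(cs.ξ : ℂ)⁻¹ • (K ⟨p.src, p.μ⟩ + K ⟨p.src.shift p.μ, p.ν⟩ - K ⟨p.src.shift p.ν, p.μ⟩ -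
      K ⟨p.src, p.ν⟩) - (τ : ℂ) • ℓ p‖ < c.B₃ * (c.B₃ * c.O₁ * c.M * c.α₀ * (c.L ^ (j - 1) * η)) ^ 2)
    (hA : ∀ b ∈ Y.bonds, ‖A b‖ ≤ c.B₃ * n)
    (hdA : ∀ q ∈ Y.dpairs, ‖grad cs.ξ q.2.1 (fun y => A ⟨y, q.2.2⟩) q.1‖ ≤ c.B₃ * n)
    (hJY : ∀ b ∈ Y.bonds, ‖current LinearMap.id cs.ξ (fun b => expI cs.ξ (K b + A b)) b‖ <
      (1 + 3 * c.β) * c.α₀ * (c.L ^ (j - 1) * η) ^ 3 + 3 * c.β * c.α₀ * (c.L ^ (j - 1) * η) ^ 2 + B₃'' * c.α₃ +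
        c.β * c.L⁻¹ ^ 2 * c.α₀)
    {uj : Site P i → 𝔸ˣ} {ubar w₁ : ℕ → Site P i → 𝔸ˣ} {ctr : ℕ → Site P i → Site P i}
    (huj : ∀ y, ‖(uj y : 𝔸)‖ * ‖(↑(uj y)⁻¹ : 𝔸)‖ ≤ Real.exp (c.B₃ ^ 2 * c.O₁ * c.M * c.α₀))
    (hubar : ∀ n x, ubar n x = uj (ctr n x))
    (h338 : ∀ m, 1 ≤ m → m ≤ cs.j → ∀ p ∈ F.X₂.plaqs, plaq (F.bg.Un m (fun b => expI cs.ξ (K b + A b))) p =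
      plaq (gaugeU (uj * (ubar m)⁻¹) (fun b => expI cs.ξ (K b + A b))) p)
    (hJn : ∀ m, 1 ≤ m → m ≤ cs.j → ∀ b ∈ F.X₂.bonds, F.bg.Jn m (fun b => expI cs.ξ (K b + A b)) b =
      current LinearMap.id (cs.L ^ m)⁻¹ (gaugeU (uj * (ubar m)⁻¹) (fun b => expI cs.ξ (K b + A b))) b)
    (h338₁ : ∀ m, 1 ≤ m → m ≤ cs.j → ∀ p ∈ F.X₂.plaqs,
      plaq (F.bg.Un m (1 : PBond P i → 𝔸ˣ)) p = plaq (gaugeU (w₁ m) (1 : PBond P i → 𝔸ˣ)) p)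
    (hJn₁ : ∀ m, 1 ≤ m → m ≤ cs.j → ∀ b ∈ F.X₂.bonds,
      F.bg.Jn m (1 : PBond P i → 𝔸ˣ) b = current LinearMap.id (cs.L ^ m)⁻¹ (gaugeU (w₁ m) (1 : PBond P i → 𝔸ˣ)) b) :
    ofBackground LinearMap.id cs.ξ (fun b => expI cs.ξ (K b + A b)) ∈ space' (unitaryModel 𝔸) F cs c.α₀ c.α₁ :=
  ofBackground_mem_space'_lemma4_of_eq338 (unitaryModel 𝔸) c hR hB hY hα₁ hL10 hξ hξ1 hcB hL hLξ hη hj hscale hξx hτ0 hτ1 hn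
    hres'' (unitaryModel_heGc cs.ξ) LinearMap.id (unitaryModel_hπ LinearMap.id) unitaryModel_hgc_Gc (fun _ _ => rfl) hXb hXd hX₂b
    hX₂p hXp (fun _ => mem_unitaryModel_gc _) (fun _ => mem_unitaryModel_gc _) h41 hH h45 hK hK1 h45τ hA hdA hJY huj hubar h338
    hJn h338₁ hJn₁

/-! ## §2. The `SU(N)` model, `π = slProj N` -/

/-- `M_N(ℂ)`. -/
local notation "M[" N "]" => Matrix (Fin N) (Fin N) ℂ

attribute [local instance] B10Eq29TubeLine.cstarAlgebraMatrix

/-- **Lemma 4 for the printed pair `(𝐔, J(𝐔))` with (iv) derived from (3.38), `SU(N)` model** (`G = SU(N)`, `Gᶜ = SL(N, ℂ)`,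
`𝔤ᶜ = 𝔰𝔩(N, ℂ)`, `π = slProj N` the projection onto `𝔤ᶜ` along `ℂ·1`): `B12Lemma4CondIV.ofBackground_mem_space'_lemma4_of_eq338` with `heGc`
(`suModel_heGc`), `hπ` (`slProj_mem_suModel_gc`), `hgc` (`suModel_hgc_Gc`) and `hπR` (`slProj_conj`, for every `GL(N, ℂ)`-valued rotation)
discharged; `𝐊 = 𝐇_j(□₀, τQ(…))`, `𝐀₂` traceless. [cite: Balaban1987RG1, Lemma 4 (3.53) p.280 with (3.38) p.278 and (1.8) p.261] -/
theorem ofBackground_mem_space'_lemma4_of_eq338_su {N : ℕ} (c : B12Sec2to5.Lemma4Consts) (hR : B12Sec2to5.Lemma4Restrictions c)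
    (hB : 1 ≤ c.B₃) (hY : 1 ≤ c.B₃ ^ 2 * c.O₁ * c.M) (hα₁ : 16 * (c.O₁ * c.M * c.α₁) ≤ c.β) (hL10 : 1 + 10 * c.β ≤ c.L ^ 2)
    {F : Frame P i M[N]} {cs : StepConsts} (hξ : 0 < cs.ξ) (hξ1 : cs.ξ ≤ 1) (hcB : 0 < cs.cB)
    (hL : 1 ≤ cs.L) (hLξ : cs.L ^ cs.j * cs.ξ = 1)
    {η τ n B₃'' : ℝ} {j : ℕ} (hη : 0 ≤ η) (hj : 1 ≤ j) (hscale : c.L ^ j * η ≤ 1)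
    (hξx : cs.ξ * (c.L ^ (j - 1) * η) = c.L⁻¹ * η) (hτ0 : 0 ≤ τ) (hτ1 : τ ≤ 1) (hn : n < c.α₃)
    (hres'' : B₃'' * c.α₃ ≤ c.β * c.L⁻¹ ^ 2 * c.α₀)
    {Y : Region P i} (hXb : F.X.bonds ⊆ Y.bonds) (hXd : F.X.dpairs ⊆ Y.dpairs) (hX₂b : F.X₂.bonds ⊆ Y.bonds)
    (hX₂p : F.X₂.plaqs ⊆ F.X.plaqs)
    (hXp : ∀ p ∈ F.X.plaqs, (⟨p.src, p.μ⟩ : PBond P i) ∈ Y.bonds ∧ (⟨p.src.shift p.μ, p.ν⟩ : PBond P i) ∈ Y.bonds ∧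
      (⟨p.src.shift p.ν, p.μ⟩ : PBond P i) ∈ Y.bonds ∧ (⟨p.src, p.ν⟩ : PBond P i) ∈ Y.bonds ∧
      (p.src, p.μ, p.ν) ∈ Y.dpairs ∧ (p.src, p.ν, p.μ) ∈ Y.dpairs)
    {H K A : PBond P i → M[N]} {ℓ : Plaq P i → M[N]}
    (hKtr : ∀ b, (K b).trace = 0) (hAtr : ∀ b, (A b).trace = 0)
    (h41 : ∀ p ∈ F.X.plaqs, ‖((plaq (fun b => expI cs.ξ (H b)) p : (M[N])ˣ) : M[N]) - 1‖ <
      Real.exp (c.B₃ ^ 2 * c.O₁ * c.M * c.α₀) * Real.exp (c.B₃ * c.O₁ * c.M * c.α₀) *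
      Real.exp (c.B₃ * c.O₁ * c.M * c.α₀) * Real.exp (c.O₁ * c.M * c.α₁) *
      ((1 + 2 * c.β) * c.α₀ * (c.L⁻¹ * η) ^ 2))
    (hH : ∀ b ∈ Y.bonds, ‖H b‖ < c.B₃ ^ 2 * c.O₁ * c.M * c.α₀ * (c.L ^ (j - 1) * η))
    (h45 : ∀ p ∈ F.X.plaqs, ‖(cs.ξ : ℂ)⁻¹ • (H ⟨p.src, p.μ⟩ + H ⟨p.src.shift p.μ, p.ν⟩ - H ⟨p.src.shift p.ν, p.μ⟩ -
      H ⟨p.src, p.ν⟩) - ℓ p‖ < c.B₃ * (c.B₃ * c.O₁ * c.M * c.α₀ * (c.L ^ (j - 1) * η)) ^ 2)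
    (hK : ∀ b ∈ Y.bonds, ‖K b‖ < c.B₃ ^ 2 * c.O₁ * c.M * c.α₀ * (c.L ^ (j - 1) * η))
    (hK1 : ∀ q ∈ Y.dpairs, ‖grad cs.ξ q.2.1 (fun y => K ⟨y, q.2.2⟩) q.1‖ < c.B₃ ^ 2 * c.O₁ * c.M * c.α₀ * (c.L ^ (j - 1) * η))
    (h45τ : ∀ p ∈ F.X.plaqs, ‖(cs.ξ : ℂ)⁻¹ • (K ⟨p.src, p.μ⟩ + K ⟨p.src.shift p.μ, p.ν⟩ - K ⟨p.src.shift p.ν, p.μ⟩ -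
      K ⟨p.src, p.ν⟩) - (τ : ℂ) • ℓ p‖ < c.B₃ * (c.B₃ * c.O₁ * c.M * c.α₀ * (c.L ^ (j - 1) * η)) ^ 2)
    (hA : ∀ b ∈ Y.bonds, ‖A b‖ ≤ c.B₃ * n)
    (hdA : ∀ q ∈ Y.dpairs, ‖grad cs.ξ q.2.1 (fun y => A ⟨y, q.2.2⟩) q.1‖ ≤ c.B₃ * n)
    (hJY : ∀ b ∈ Y.bonds, ‖current (slProj N) cs.ξ (fun b => expI cs.ξ (K b + A b)) b‖ <
      (1 + 3 * c.β) * c.α₀ * (c.L ^ (j - 1) * η) ^ 3 + 3 * c.β * c.α₀ * (c.L ^ (j - 1) * η) ^ 2 + B₃'' * c.α₃ +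
        c.β * c.L⁻¹ ^ 2 * c.α₀)
    {uj : Site P i → (M[N])ˣ} {ubar w₁ : ℕ → Site P i → (M[N])ˣ} {ctr : ℕ → Site P i → Site P i}
    (huj : ∀ y, ‖(uj y : M[N])‖ * ‖(↑(uj y)⁻¹ : M[N])‖ ≤ Real.exp (c.B₃ ^ 2 * c.O₁ * c.M * c.α₀))
    (hubar : ∀ n x, ubar n x = uj (ctr n x))
    (h338 : ∀ m, 1 ≤ m → m ≤ cs.j → ∀ p ∈ F.X₂.plaqs, plaq (F.bg.Un m (fun b => expI cs.ξ (K b + A b))) p =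
      plaq (gaugeU (uj * (ubar m)⁻¹) (fun b => expI cs.ξ (K b + A b))) p)
    (hJn : ∀ m, 1 ≤ m → m ≤ cs.j → ∀ b ∈ F.X₂.bonds, F.bg.Jn m (fun b => expI cs.ξ (K b + A b)) b =
      current (slProj N) (cs.L ^ m)⁻¹ (gaugeU (uj * (ubar m)⁻¹) (fun b => expI cs.ξ (K b + A b))) b)
    (h338₁ : ∀ m, 1 ≤ m → m ≤ cs.j → ∀ p ∈ F.X₂.plaqs,
      plaq (F.bg.Un m (1 : PBond P i → (M[N])ˣ)) p = plaq (gaugeU (w₁ m) (1 : PBond P i → (M[N])ˣ)) p)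
    (hJn₁ : ∀ m, 1 ≤ m → m ≤ cs.j → ∀ b ∈ F.X₂.bonds,
      F.bg.Jn m (1 : PBond P i → (M[N])ˣ) b = current (slProj N) (cs.L ^ m)⁻¹ (gaugeU (w₁ m) (1 : PBond P i → (M[N])ˣ)) b) :
    ofBackground (slProj N) cs.ξ (fun b => expI cs.ξ (K b + A b)) ∈ space' (suModel N) F cs c.α₀ c.α₁ :=
  ofBackground_mem_space'_lemma4_of_eq338 (suModel N) c hR hB hY hα₁ hL10 hξ hξ1 hcB hL hLξ hη hj hscale hξx hτ0 hτ1 hn hres''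
    (suModel_heGc cs.ξ) (slProj N) slProj_mem_suModel_gc suModel_hgc_Gc (fun g X => slProj_conj g X) hXb hXd hX₂b hX₂p hXp
    (fun b => mem_suModel_gc.2 (hKtr b)) (fun b => mem_suModel_gc.2 (hAtr b)) h41 hH h45 hK hK1 h45τ hA hdA hJY huj hubar h338 hJn
    h338₁ hJn₁

/-! ## §3. The gauge clause for the printed pair in the two models: membership is decided on the orbit -/

/-- **`(𝐔^u, J(𝐔^u)) ∈ U^c_j ↔ (𝐔, J(𝐔)) ∈ U^c_j`, `U(N)`-type model, `π = id`**, for every (`Gᶜ = 𝔸ˣ`-valued) gauge transformation `u`: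
(1.9) intertwines (1.10) (`B12Eq18Current.ofBackground_gaugeU`) and the spaces are unions of `Gᶜ`-orbits
(`B12RegularSpaces111.act_mem_space_iff`) — the orbit statement behind p. 277 «the orbit of the configuration U_j(□₀, …) above contains the
configuration exp iξ𝐇_j(…)» and (3.38)'s `U_n(X, M˙(V)) = V^{u_j(ū_j)⁻¹}`. [cite: Balaban1987RG1, (1.19) p.263] -/
theorem ofBackground_gaugeU_mem_space_iff_unitary {𝔸 : Type*} [NormedRing 𝔸] [NormedAlgebra ℂ 𝔸] [CompleteSpace 𝔸] [StarRing 𝔸]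
    {F : Frame P i 𝔸} {cs : StepConsts} {α₀ α₁ γ₀ : ℝ} (ξ : ℝ) (u : Site P i → 𝔸ˣ) (U : PBond P i → 𝔸ˣ) :
    ofBackground LinearMap.id ξ (gaugeU u U) ∈ space (unitaryModel 𝔸) F cs α₀ α₁ γ₀ ↔
      ofBackground LinearMap.id ξ U ∈ space (unitaryModel 𝔸) F cs α₀ α₁ γ₀ := by
  rw [ofBackground_gaugeU LinearMap.id ξ u (fun _ _ => rfl) U]
  exact act_mem_space_iff _ fun x => mem_unitaryModel_Gc (u x)

/-- **`(𝐔^u, J(𝐔^u)) ∈ U^c_j ↔ (𝐔, J(𝐔)) ∈ U^c_j`, `SU(N)` model, `π = slProj N`**, for every `SL(N, ℂ)`-valued gauge transformation `u`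
(`B12Lemma4Models.ofBackground_gaugeU_su` + `B12RegularSpaces111.act_mem_space_iff`). [cite: Balaban1987RG1, (1.19) p.263] -/
theorem ofBackground_gaugeU_mem_space_iff_su {N : ℕ} {F : Frame P i M[N]} {cs : StepConsts} {α₀ α₁ γ₀ : ℝ} (ξ : ℝ)
    {u : Site P i → (M[N])ˣ} (hu : ∀ x, u x ∈ (suModel N).Gc) (U : PBond P i → (M[N])ˣ) :
    ofBackground (slProj N) ξ (gaugeU u U) ∈ space (suModel N) F cs α₀ α₁ γ₀ ↔
      ofBackground (slProj N) ξ U ∈ space (suModel N) F cs α₀ α₁ γ₀ := by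
  rw [ofBackground_gaugeU_su ξ u U]
  exact act_mem_space_iff _ hu

end

end Literature.MathematicalPhysics.QuantumFieldTheory.Balaban1983to89.B12Lemma4CondIVModels
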